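import Summits.QuantumFields.BalabanUV.T4Continuum.Support.ShellMeasureCellGaugeFromPlaquettes
import Summits.QuantumFields.BalabanUV.T4Continuum.Support.ShellMeasureDecayRowsDirInvCells

/-!
# `T4Continuum.ShellMeasureCellGaugeFromPlaquettesRows` — ROW S119 = J4, FILE 3: THE FIRST BY-NAME JUNCTION OF THE J-LANE — ROW J3's
# E6-SHAPE DECAY ROW (`ShellMeasureDecayRowsLevelOpCells.decayRow_levelOp_cells_cov`, leaf-02-g13) WITH ITS (3.35)-GAUGE DATUM SUPPLIED
# BY S119 f1 (`cellGauge`, `hgauge_of_plaquettes`, `hloss_of_plaquettes`): the decay row `‖k c b′‖ ≤ c𝒢·e^{−κ·sdist}` for the cell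
# blocks of `(levelOp)⁻¹` from IN-CELL PLAQUETTE-SMALLNESS of the background, `θ = 8d⁴α₀²`
(cell `pub-balaban`, sub-cell `t4`, spine estimate NE7c (node U5b); NE7c ROUND-2 crew, unit `b2b-balaban-t4-ne7c-formalise-leaf-01` gen 12;
ROW S119 = J4 (R-ne7cp1-g37-8 (d)); ADDITIVE — imports S119 f1 + ROW J3 = S118's file 2 `ShellMeasureDecayRowsDirInvCells` (hence file 1) ONLY, BY
NAME; touches NO host, moves NO census row; [folklore]; 0 def, 0 `def … : Prop`, 0 sorry, 0 citation tags)

HONEST FRAMING.  Finite four-torus programme, rung (B)+1 only — NOT infinite volume, NOT a mass gap, NOT the Clay problem, NOT summit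
progress; (B), `BetaPertHyp`, (B^μ) not consumed and NOT discharged.  NE7c NOT PRINTED in [Balaban 1983–89], NOT PROVED; «NE7c ⇐ the named
binders» (c3).  MODEL-side bookkeeping (pv21's torus `levelOp`, ℓ²-fibre reading); nothing of Bałaban's instantiated, asserted, cited or
discharged; which `Rm`, which cells, which normalisation = node O ∕ J2 ∕ J1.  HONEST DEPENDENCY (cell): continuum YM on T⁴ ⇐ BetaPertH ∧
nine spine estimates (0/9 proved); BetaPertH ⇐ (D1) ∧ (D4) ∧ CAP+tail; G-an2-4 gates asym, D1 and NE2/3/4.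
-/

noncomputable section

open scoped BigOperators Matrix Matrix.Norms.L2Operator
open Finset Function

namespace Summit.QuantumFields.BalabanUV.T4Continuum.ShellMeasureCellGaugeFromPlaquettesRows

open Summit.QuantumFields.BalabanUV.Beta
open Summit.QuantumFields.BalabanUV.Beta.BoxPoincare (Box)
open Summit.QuantumFields.BalabanUV.Beta.CovariantBoxPoincare (hol succ)
open Summit.QuantumFields.BalabanUV.Beta.MultiscaleCoerciveTorus
open Summit.QuantumFields.BalabanUV.Beta.MultiscaleDistance
open Summit.QuantumFields.BalabanUV.Beta.MultiscaleDecayBudget (siteScale cellOf)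
open Summit.QuantumFields.BalabanUV.Beta.ThinLoopHolonomy (cpxHom)
open Summit.QuantumFields.BalabanUV.T4Continuum.ShellMeasureCellGaugeFromPlaquettes
open Summit.QuantumFields.BalabanUV.T4Continuum.ShellMeasureDecayRowsLevelOpCells (decayRow_levelOp_cells_cov)
open Summit.QuantumFields.BalabanUV.T4Continuum.ShellMeasureDecayRowsDirInvCells (decayRow_dirInv_cells)
open Summit.QuantumFields.BalabanUV.Beta.MultiscaleCoerciveTorusCov (multiscale_coercive_torus_cov)
open Literature.MathematicalPhysics.QuantumFieldTheory.Balaban1983to89.B9Thm37GlueTorusInv (dirInv)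
open Literature.MathematicalPhysics.QuantumFieldTheory.Balaban1983to89
open Literature.MathematicalPhysics.QuantumFieldTheory.Balaban1983to89.B9Thm37GluePU (bsrc btgt)
open Literature.MathematicalPhysics.QuantumFieldTheory.Balaban1983to89.B9Thm37GlueTorusCov (tblk torusComb)
open Literature.MathematicalPhysics.QuantumFieldTheory.Balaban1983to89.B9Thm37GlueTorusCovLevels (levelOp)
open B5TorusCover (UT Ctr ctrU)

variable {d : ℕ} {N : Fin d → ℕ} [∀ i, NeZero (N i)] [NeZero d] {Cp J K : Type} [Fintype Cp] [DecidableEq Cp] [Nonempty Cp]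
  [Fintype J] [Fintype K] [DecidableEq K] (S : J → ℕ) (hS : ∀ l, 1 ≤ S l) (hdivS : ∀ l i, S l ∣ N i) (lvl : K → J)
  (zc : (k : K) → Ctr N (S (lvl k)))

/-- **ROW J3's E6-SHAPE DECAY ROW FROM IN-CELL PLAQUETTE-SMALLNESS** (`decayRow_levelOp_cells_cov` BY NAME with
`(g, hg, ε, hε, hgauge, hloss) := (cellGauge, cellGauge_orth, d(S_k−1)α_k, _, hgauge_of_plaquettes, hloss_of_plaquettes)` from S119 f1):
for ALL cells `c b′`, `‖block c b′‖ ≤ (e^{4dκ}S_max²∕μ₀)·exp(−(κ·sdist (corner c) (corner b′)))` with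
`μ₀ = (1 − 8d⁴α₀²)·min(c_min²∕(4d), a_min∕4) − 2d·c_max²κ² − a_max(e^{2dκ} − 1) > 0`, field hypothesis = «every in-cell plaquette of `Rm`
within `α_k` of `1`, `S_k²·α_k ≤ α₀`». [folklore] -/
theorem decayRow_levelOp_cells_of_plaquettes
    (hdisj : ∀ k k' v v', cellPt S hS hdivS lvl zc k v = cellPt S hS hdivS lvl zc k' v' → k = k')
    (hcover : ∀ x : UT N, ∃ k, ∃ v : Box d (S (lvl k)), cellPt S hS hdivS lvl zc k v = x)
    (Rm : UT N × Fin d → Cp → Cp → ℝ) (hRm : ∀ b i j, ∑ k, Rm b k i * Rm b k j = if i = j then (1 : ℝ) else 0)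
    (a : J → ℝ) (ha : ∀ j, 0 ≤ a j) (ω : J → UT N → ℝ)
    (hsupp : ∀ l x, ω l (ctrU N (S l) (tblk (hS l) (hdivS l) x)) ≠ 0 → ∃ k v, lvl k = l ∧ cellPt S hS hdivS lvl zc k v = x)
    {amin amax : ℝ} (hamin : 0 ≤ amin) (hamax : 0 ≤ amax)
    (hscale_lo : ∀ k, amin / (S (lvl k) : ℝ) ^ 2 ≤ a (lvl k) * ω (lvl k) (ctrU N (S (lvl k)) (zc k)) ^ 2 * (S (lvl k) : ℝ) ^ d)
    (hscale_hi : ∀ k, a (lvl k) * ω (lvl k) (ctrU N (S (lvl k)) (zc k)) ^ 2 * (S (lvl k) : ℝ) ^ d ≤ amax / (S (lvl k) : ℝ) ^ 2)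
    (c : UT N × Fin d → ℝ) {cmin cmax : ℝ} (hcmin : 0 < cmin) (hc_lo : ∀ b, cmin ≤ |c b|) (hc_hi : ∀ b, |c b| ≤ cmax)
    (α : K → ℝ) (hα : ∀ k, 0 ≤ α k) {α₀ : ℝ} (hαS : ∀ k, (S (lvl k) : ℝ) ^ 2 * α k ≤ α₀)
    (hplaq : ∀ k (v : Box d (S (lvl k))) (κ μ : Fin d) (hκ : (v κ : ℕ) + 1 < S (lvl k)) (hμ : (v μ : ℕ) + 1 < S (lvl k)),
      κ ≠ μ → ‖cpxHom (cellPlaq S hS hdivS lvl zc Rm k v κ μ hκ hμ) - 1‖ ≤ α k)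
    {κ : ℝ} (hκ0 : 0 ≤ κ) (hκ1 : κ ≤ 1)
    (hμ : 0 < (1 - 8 * (d : ℝ) ^ 4 * α₀ ^ 2) * min (cmin ^ 2 / (4 * d)) (amin / 4) - 2 * d * cmax ^ 2 * κ ^ 2 -
      amax * (Real.exp (2 * d * κ) - 1))
    {Smax : ℝ} (hSmax : ∀ k, (S (lvl k) : ℝ) ≤ Smax) (cc b' : K) :
    ‖Matrix.toEuclideanCLM (n := UT N × Cp) (𝕜 := ℂ)
        ((Matrix.of fun p q : UT N × Cp =>
          if cellOf S hS hdivS lvl zc hcover p.1 = cc ∧ cellOf S hS hdivS lvl zc hcover q.1 = b' then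
            (Ring.inverse (levelOp bsrc btgt c Rm (fun l x => ctrU N (S l) (tblk (hS l) (hdivS l) x))
              (fun l x => ω l (ctrU N (S l) (tblk (hS l) (hdivS l) x))) (fun l x => (torusComb (hS l) (hdivS l)).tr Rm x) a))
              (Pi.single q 1) p
          else 0).map Complex.ofReal)‖ ≤
      (Real.exp (4 * d * κ) * Smax ^ 2 /
          ((1 - 8 * (d : ℝ) ^ 4 * α₀ ^ 2) * min (cmin ^ 2 / (4 * d)) (amin / 4) - 2 * d * cmax ^ 2 * κ ^ 2 -
            amax * (Real.exp (2 * d * κ) - 1))) *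
        Real.exp (-(κ * sdist bsrc btgt (siteScale S hS hdivS lvl zc hcover) (ctrU N (S (lvl cc)) (zc cc))
          (ctrU N (S (lvl b')) (zc b')))) :=
  decayRow_levelOp_cells_cov S hS hdivS lvl zc hdisj hcover Rm hRm a ha ω hsupp hamax hscale_hi c hc_hi hκ0 hκ1 hamin hscale_lo
    hcmin hc_lo (cellGauge S hS hdivS lvl zc Rm hRm) (cellGauge_orth S hS hdivS lvl zc Rm hRm)
    (fun k => d * ((S (lvl k) : ℝ) - 1) * α k)
    (fun k => by
      have hs : (1 : ℝ) ≤ S (lvl k) := by exact_mod_cast hS (lvl k)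
      have := hα k
      have : (0 : ℝ) ≤ (S (lvl k) : ℝ) - 1 := by linarith
      positivity)
    (fun k v i hv u => hgauge_of_plaquettes S hS hdivS lvl zc Rm hRm k (hα k) (hplaq k) v i hv u)
    (fun k => hloss_of_plaquettes S hS lvl α hα hαS k) hμ hSmax cc b'

/-- **ROW J3's DIRICHLET-SECTIONED E6 ROW FROM IN-CELL PLAQUETTE-SMALLNESS, EVERY DOMAIN** (`ShellMeasureDecayRowsDirInvCells.decayRow_dirInv_cells`
BY NAME with the comb contour transports as level transports and its cell-sum coercivity `hcoer` SUPPLIED by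
`MultiscaleCoerciveTorusCov.multiscale_coercive_torus_cov` at the designed gauge `(cellGauge, cellGauge_orth, d(S_k−1)α_k, _,
hgauge_of_plaquettes, hloss_of_plaquettes)`): for every {0,1}-valued domain indicator `χ` and ALL cells `c b′`,
`‖block_χ c b′‖ ≤ (e^{4dκ}S_max²∕min(μ₀,1))·exp(−(κ·sdist (corner c) (corner b′)))`, `μ₀` as above — the (α4)-sectioned decay row with the
field hypothesis «plaquette-small on the cells». [folklore] -/
theorem decayRow_dirInv_cells_of_plaquettes
    (hdisj : ∀ k k' v v', cellPt S hS hdivS lvl zc k v = cellPt S hS hdivS lvl zc k' v' → k = k')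
    (hcover : ∀ x : UT N, ∃ k, ∃ v : Box d (S (lvl k)), cellPt S hS hdivS lvl zc k v = x)
    (Rm : UT N × Fin d → Cp → Cp → ℝ) (hRm : ∀ b i j, ∑ k, Rm b k i * Rm b k j = if i = j then (1 : ℝ) else 0)
    (a : J → ℝ) (ha : ∀ j, 0 ≤ a j) (ω : J → UT N → ℝ)
    (hsupp : ∀ l x, ω l (ctrU N (S l) (tblk (hS l) (hdivS l) x)) ≠ 0 → ∃ k v, lvl k = l ∧ cellPt S hS hdivS lvl zc k v = x)
    {amin amax : ℝ} (hamin : 0 ≤ amin) (hamax : 0 ≤ amax)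
    (hscale_lo : ∀ k, amin / (S (lvl k) : ℝ) ^ 2 ≤ a (lvl k) * ω (lvl k) (ctrU N (S (lvl k)) (zc k)) ^ 2 * (S (lvl k) : ℝ) ^ d)
    (hscale_hi : ∀ k, a (lvl k) * ω (lvl k) (ctrU N (S (lvl k)) (zc k)) ^ 2 * (S (lvl k) : ℝ) ^ d ≤ amax / (S (lvl k) : ℝ) ^ 2)
    (c : UT N × Fin d → ℝ) {cmin cmax : ℝ} (hcmin : 0 < cmin) (hc_lo : ∀ b, cmin ≤ |c b|) (hc_hi : ∀ b, |c b| ≤ cmax)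
    (α : K → ℝ) (hα : ∀ k, 0 ≤ α k) {α₀ : ℝ} (hαS : ∀ k, (S (lvl k) : ℝ) ^ 2 * α k ≤ α₀)
    (hplaq : ∀ k (v : Box d (S (lvl k))) (κ μ : Fin d) (hκ : (v κ : ℕ) + 1 < S (lvl k)) (hμ : (v μ : ℕ) + 1 < S (lvl k)),
      κ ≠ μ → ‖cpxHom (cellPlaq S hS hdivS lvl zc Rm k v κ μ hκ hμ) - 1‖ ≤ α k)
    {κ : ℝ} (hκ0 : 0 ≤ κ) (hκ1 : κ ≤ 1)
    (hμ : 0 < (1 - 8 * (d : ℝ) ^ 4 * α₀ ^ 2) * min (cmin ^ 2 / (4 * d)) (amin / 4) - 2 * d * cmax ^ 2 * κ ^ 2 -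
      amax * (Real.exp (2 * d * κ) - 1))
    (χ : UT N × Cp → ℝ) (hχ : ∀ p, χ p = 0 ∨ χ p = 1)
    {Smax : ℝ} (hSmax : ∀ k, (S (lvl k) : ℝ) ≤ Smax) (cc b' : K) :
    ‖Matrix.toEuclideanCLM (n := UT N × Cp) (𝕜 := ℂ)
        ((Matrix.of fun p q : UT N × Cp =>
          if cellOf S hS hdivS lvl zc hcover p.1 = cc ∧ cellOf S hS hdivS lvl zc hcover q.1 = b' then
            (dirInv (levelOp bsrc btgt c Rm (fun l x => ctrU N (S l) (tblk (hS l) (hdivS l) x))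
              (fun l x => ω l (ctrU N (S l) (tblk (hS l) (hdivS l) x))) (fun l x => (torusComb (hS l) (hdivS l)).tr Rm x) a) χ)
              (Pi.single q 1) p
          else 0).map Complex.ofReal)‖ ≤
      (Real.exp (4 * d * κ) * Smax ^ 2 /
          min ((1 - 8 * (d : ℝ) ^ 4 * α₀ ^ 2) * min (cmin ^ 2 / (4 * d)) (amin / 4) - 2 * d * cmax ^ 2 * κ ^ 2 -
            amax * (Real.exp (2 * d * κ) - 1)) 1) *
        Real.exp (-(κ * sdist bsrc btgt (siteScale S hS hdivS lvl zc hcover) (ctrU N (S (lvl cc)) (zc cc))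
          (ctrU N (S (lvl b')) (zc b')))) :=
  decayRow_dirInv_cells S hS hdivS lvl zc hdisj hcover Rm hRm (fun l x => (torusComb (hS l) (hdivS l)).tr Rm x)
    (fun l x i i' => (torusComb (hS l) (hdivS l)).tr_orth Rm hRm x i i') a ha ω hsupp hamax hscale_hi c hc_hi
    (fun f => multiscale_coercive_torus_cov (Nat.one_le_iff_ne_zero.mpr (NeZero.ne d)) S hS hdivS Rm hRm a ha ω c hcmin hc_lo lvl zc
      hdisj hamin hscale_lo (cellGauge S hS hdivS lvl zc Rm hRm) (cellGauge_orth S hS hdivS lvl zc Rm hRm)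
      (fun k => d * ((S (lvl k) : ℝ) - 1) * α k)
      (fun k => by
        have hs : (1 : ℝ) ≤ S (lvl k) := by exact_mod_cast hS (lvl k)
        have := hα k
        have : (0 : ℝ) ≤ (S (lvl k) : ℝ) - 1 := by linarith
        positivity)
      (fun k v i hv u => hgauge_of_plaquettes S hS hdivS lvl zc Rm hRm k (hα k) (hplaq k) v i hv u)
      (fun k => hloss_of_plaquettes S hS lvl α hα hαS k) f)
    hκ0 hκ1 hμ χ hχ hSmax cc b'

end Summit.QuantumFields.BalabanUV.T4Continuum.ShellMeasureCellGaugeFromPlaquettesRows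

end
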